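import Mathlib
import Summits.AtomisticToContinuum.Crystallization.Theorems.NashClassCertificatesNashNearFieldStubCauchyBornBarlowCoercivityWordFree

/-!
# Crux `NashNearField` (stmt-AtomisticToContinuum-16827), line `birth`, stub `stub_layerLandscapeTenth` (LL⅒):
# the word-free excess vanishes on the box family (the NEAR claim is sharp)

In the triangular gauge of `…StubLayerLandscapeTri`, the box family is `t = (a, 0, 0, a, 0, h/h₀)` (`h₀ = √6/3`).  There every
layer excess `Δ(δ, s) = ∑'_{(i,j)} V_LJ(√((aX)² + (aY)² + ((h/h₀)Z)²)) − layerInteraction V_LJ a h δ s` vanishes term by term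
(`‖layerVec a h δ s i j‖² = (aX)² + (aY)² + (s h)²`), so the word-free functional `W` is `0`: `stub_triFamilyZero`.  Together with
`W ≥ 0`-type floors this pins the constant of `stub_triLandscapeNear` to the transverse/outward growth rates only, and it is the
`S = 0` anchor of any Taylor-model certificate (value and, by the `C₃` symmetry, transverse gradient vanish on the family).
-/

noncomputable section

open scoped BigOperators
open Literature.MathematicalPhysics.StatisticalMechanics Literature.Geometry.DiscreteGeometry

namespace Summit.AtomisticToContinuum.Crystallization.Theorems.NashClassCertificatesNashNearField

/-- On the family the deformed distance is the reference distance: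
`(aX)² + (aY)² + ((h/h₀)·s h₀)² = ‖layerVec a h δ s i j‖²`. [folklore] -/
theorem tri_family_sq_eq (a h : ℝ) (δ s i j : ℤ) :
    (a * ((i : ℝ) + (j : ℝ) / 2 + (δ : ℝ) / 2) + (0 : ℝ) * (Real.sqrt 3 / 2 * ((j : ℝ) + (δ : ℝ) / 3)) + (0 : ℝ) * ((s : ℝ) * (Real.sqrt 6 / 3))) ^ 2 + (a * (Real.sqrt 3 / 2 * ((j : ℝ) + (δ : ℝ) / 3)) + (0 : ℝ) * ((s : ℝ) * (Real.sqrt 6 / 3))) ^ 2 + ((h / (Real.sqrt 6 / 3)) * ((s : ℝ) * (Real.sqrt 6 / 3))) ^ 2 = ‖layerVec a h δ s i j‖ ^ 2 := by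
  rw [norm_layerVec, Real.sq_sqrt (by positivity)]
  have h6 : Real.sqrt 6 / 3 ≠ 0 := by positivity
  field_simp
  ring

/-- **Stub piece `stub_triFamilyZero` (proved): the word-free excess vanishes on the box family.**  At
`t = (a, 0, 0, a, 0, h/h₀)` every layer excess is `0`, hence `W = ½(0 + ∑' min 0 0 + ∑' min 0 0) = 0`. [folklore] -/
theorem stub_triFamilyZero :
    ∀ a h : ℝ, 0 < a → 0 < h →
      (fun Δ : ℤ → ℤ → ℝ => (1 / 2 : ℝ) * (Δ 0 0 +
            (∑' k : ℕ, if k = 0 then min (Δ 1 1) (Δ (-1) 1)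
              else min (Δ 0 ((k : ℤ) + 1)) (min (Δ 1 ((k : ℤ) + 1)) (Δ (-1) ((k : ℤ) + 1)))) +
            (∑' k : ℕ, if k = 0 then min (Δ 1 (-1)) (Δ (-1) (-1))
              else min (Δ 0 (-((k : ℤ) + 1))) (min (Δ 1 (-((k : ℤ) + 1))) (Δ (-1) (-((k : ℤ) + 1)))))))
          (fun δ s => (∑' ij : ℤ × ℤ, lennardJones (Real.sqrt ((a * ((ij.1 : ℝ) + (ij.2 : ℝ) / 2 + (δ : ℝ) / 2) + (0 : ℝ) * (Real.sqrt 3 / 2 * ((ij.2 : ℝ) + (δ : ℝ) / 3)) + (0 : ℝ) * ((s : ℝ) * (Real.sqrt 6 / 3))) ^ 2 + (a * (Real.sqrt 3 / 2 * ((ij.2 : ℝ) + (δ : ℝ) / 3)) + (0 : ℝ) * ((s : ℝ) * (Real.sqrt 6 / 3))) ^ 2 + ((h / (Real.sqrt 6 / 3)) * ((s : ℝ) * (Real.sqrt 6 / 3))) ^ 2))) -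
            layerInteraction lennardJones a h δ s) = 0 := by
  intro a h ha hh
  have hΔ : (fun δ s : ℤ => (∑' ij : ℤ × ℤ, lennardJones (Real.sqrt ((a * ((ij.1 : ℝ) + (ij.2 : ℝ) / 2 + (δ : ℝ) / 2) + (0 : ℝ) * (Real.sqrt 3 / 2 * ((ij.2 : ℝ) + (δ : ℝ) / 3)) + (0 : ℝ) * ((s : ℝ) * (Real.sqrt 6 / 3))) ^ 2 + (a * (Real.sqrt 3 / 2 * ((ij.2 : ℝ) + (δ : ℝ) / 3)) + (0 : ℝ) * ((s : ℝ) * (Real.sqrt 6 / 3))) ^ 2 + ((h / (Real.sqrt 6 / 3)) * ((s : ℝ) * (Real.sqrt 6 / 3))) ^ 2))) -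
      layerInteraction lennardJones a h δ s) = fun _ _ => 0 := by
    funext δ s
    rw [sub_eq_zero, layerInteraction]
    refine tsum_congr fun ij => ?_
    rw [tri_family_sq_eq, Real.sqrt_sq (norm_nonneg _)]
  rw [hΔ]
  simp

end Summit.AtomisticToContinuum.Crystallization.Theorems.NashClassCertificatesNashNearField

end
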